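import Literature.NumberTheory.EllipticCurves.DivisionFieldUnipotentStabilizer
import Literature.NumberTheory.EllipticCurves.DivisionFieldReducibleBorelKernel
import HarnessLib

/-!
# The `2`-torsion point field `K(P) ⊆ K(E[4])` has `2`-power index: Lim's index hypothesis at `p = 2`,
# discharged structurally — and the doors it opens to Coates–Sujatha's statement (A) at `(E, 2)`

HONEST FRAMING (cell `bsd-f1-sign2`, HOME `run/shared/lean/pub/bsd-f1-sign2/`; WIDTH-5 attached prover seat
`bsd-line-att-p5` gen 2 on route `AlignedTransportAtTwo`, crux C2 `MainConjectureOfRankZeroBSDAtTwo`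
(stmt-BirchSwinnertonDyer-22298), line `birth`, stub A₂ `ClassicalMuSeedFieldsAtTwo` of the lead's ROAD (b);
`--supports` 22298; closes nothing; BSD is proved for no curve here).  THEOREMS ONLY — no definition, no named
fact, nothing asserted.  ROUTE-INDEPENDENT (imports no `Theses` file); the crux-level glue is the sibling
`…MainConjectureOfRankZeroBSDAtTwoTorsionPointFieldCrux`.

WHY.  On road (b) (lead files `…FineRoad`, `…FineRoadCrux`, `…FineRoadCoinv*`: Kato's §17.13 bookkeeping at
`𝔭 = (2)` + Coates–Sujatha's statement (A)) the class-group input is Lim 2017 Thm. 3.5 at `p = 2` (tree fact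
`Lim2017.thm35_at_two_fineSelmerDual_moduleFinite_of_classicalMuVanishes_of_le_divisionField_four`): statement (A)
at `(E, 2)` follows from Iwasawa's classical `μ = 0` for ONE subfield `L ⊆ ℚ(E[4])` with `[ℚ(E[4]) : L]` a power
of `2`.  The intended `L` is the field `ℚ(P)` of ONE non-zero `2`-torsion point (the cubic field `ℚ(e₁)` of a
root of the `2`-division cubic when `E[2]` is irreducible), on which the cell's class-number certificates
(Fukuda 1994, data ask D-att-p2-1) are computed — but its two structural properties `ℚ(P) ⊆ ℚ(E[4])` and
`[ℚ(E[4]) : ℚ(P)] = 2^k` were so far DISPLAYED AS HYPOTHESES (`hL`, `hidx` of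
`AlignedTransportAtTwoFineRoad.finite_fineSelmer_twoTorsion_of_classicalMu`: «not derived here»; likewise the
`∃ L` clause of stub A₂ and of `ByReductionTypeAtTwoAdditiveInstance8092jKatoFine`).  This file PROVES them, for
every elliptic curve over every field of characteristic `0` and every non-zero `P ∈ E[2]`, with no count of
`GL₂(ℤ/4)`:

* §1 (group-action algebra on `E(K̄)`): if `σ ∈ Γ_K` fixes `P ∈ E[2] ∖ 0` then `σQ − Q ∈ ℤP` on `E[2]`
  (`smul_sub_mem_zmultiples_of_smul_eq`: `σ` lies in the UNIPOTENT STABILISER of `P` at level `2`, the tree's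
  `WeierstrassCurve.unipotentStabilizer`), hence `σ²` fixes `E[2]`, hence `σ⁴` fixes `E[4]`
  (`sq_smul_eq_of_forall_twoTorsion_smul_eq`: `(1 + 2M)² ≡ 1 (mod 4)`; `pow_four_smul_eq_of_smul_eq`).
* §2: so the image of `Stab_{Γ_K}(P)` in `Gal(K(E[4])/K)` is a `2`-GROUP (`isPGroup_two_map_stabilizer`), its
  fixed field — which IS the torsion-point field `K(P) = K̄^{Stab(P)}` of the tree
  (`lift_fixedField_map_stabilizer_eq`; spelling of `Rank1Residual.pointField` /
  `SmallImageMu.TorsionPointFieldMuSufficesOnClassX9`) — lies below `K(E[4])`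
  (`fixedField_stabilizer_le_divisionField_four`) and `[K(E[4]) : K] = 2^k · [K(P) : K]`
  (`exists_finrank_divisionField_four_eq_pow_mul_finrank_fixedField_stabilizer`); a non-zero `P` exists
  (`exists_twoTorsion_ne_zero`, `#E[2] = 4`).
* §3 (doors for `E/ℚ` at `p = 2`, BY NAME, conditional on the named facts only): statement (A) at `(E, 2)` —
  `∃ γ D` form and the intrinsic form «`Sel₀(ℚ_∞, E[2^∞])[2]` finite» (hypothesis `hA` of the lead's
  `mazurMainConjecture_two_of_bsdp_of_fineRoad`) — from Lim 2017 at `2` + `ClassicalMuVanishes` of `ℚ(P)`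
  (`finite_fineSelmer_twoTorsion_of_classicalMu_pointField`); from Fukuda 1994 Thm. 1 (1)/(2) numerics of the
  tower `ℚ(P) ⊂ ℚ(P, √2) ⊂ ℚ(P)·ℚ(ζ₁₆)⁺ ⊂ …` (`…_of_classNumberPExp_succ_eq_pointField`,
  `…_of_classGroupPRank_succ_eq_pointField`); from Iwasawa 1956 (`…_of_not_dvd_classNumber_pointField`); and
  UNCONDITIONALLY-mod-print (Lim + Ferrero–Washington) when `ℚ(P)/ℚ` is abelian
  (`finite_fineSelmer_twoTorsion_of_abelian_pointField`: rational `2`-torsion, or cyclic cubic `2`-division field).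

On the route's cell (`E[2]` irreducible with `S₃` image) `ℚ(P)` is an `S₃`-cubic and Iwasawa's `μ₂(ℚ(P)) = 0`
is OPEN as a class-wide statement (Ferrero–Washington is abelian-only; Iwasawa 1973 transfers `μ = 0` only along
`2`-extensions) — stub A₂ remains open; what this file removes is its field-theoretic half.

References: M. F. Lim, Asian J. Math. 21 (2017) §3 Thm. 3.5, Lemma 3.2 [Lim2017FineSelmer]; J. Coates,
R. Sujatha, Math. Ann. 331 (2005) §3 [CoatesSujatha2005]; J.-P. Serre, Invent. Math. 15 (1972) §IV [Serre1972];
J. H. Silverman, AEC (2009) III.6.4, VIII.§1 [SilvermanAEC2009]; T. Fukuda, Proc. Japan Acad. 70 (1994) Thm. 1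
[Fukuda1994]; R. Greenberg, Iwasawa theory — past and present (2001) Prop. 2.1 [Greenberg2001IwasawaPastPresent];
S. Lang, Cyclotomic Fields I–II (1990) Ch. 10 §3 Thm. 3.4 [Lang1990]; J. Neukirch, ANT (1999) Ch. IV §1
[NeukirchANT1999].
-/

noncomputable section

open scoped Classical

universe u

namespace Summit.BirchSwinnertonDyer.BirchSwinnertonDyer.Theorems.AlignedTransportAtTwoTorsionPointField

open WeierstrassCurve Field Literature.NumberTheory.EllipticCurves Literature.NumberTheory.GaloisRepresentations

/-! ## §1 A Galois element fixing a non-zero `2`-torsion point acts on `E[4]` through an element of order `∣ 4` -/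

section TwoGroup

variable {K : Type u} [Field K] {W : WeierstrassCurve K}

/-- Bookkeeping: `Γ_K` commutes with integer multiples on `E(K̄)`. [folklore] -/
private theorem smul_zsmul_geomPoints (σ : absoluteGaloisGroup K) (k : ℤ) (x : geomPoints W) :
    σ • (k • x) = k • (σ • x) :=
  map_zsmul (DistribSMul.toAddMonoidHom (geomPoints W) σ) k x

/-- Bookkeeping: `Γ_K` commutes with integer multiples on `E[n]`. [folklore] -/
private theorem smul_zsmul_geomTorsion {n : ℤ} (σ : absoluteGaloisGroup K) (k : ℤ)
    (x : geomTorsion W n) : σ • (k • x) = k • (σ • x) :=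
  map_zsmul (DistribSMul.toAddMonoidHom (geomTorsion W n) σ) k x

/-- Bookkeeping: an `n`-torsion point is killed by `n` (as an element of the subtype). [folklore] -/
private theorem zsmul_self_geomTorsion {n : ℤ} (x : geomTorsion W n) : n • x = 0 := by
  apply Subtype.ext
  have h : (x : geomPoints W) ∈ AddSubgroup.torsionBy (geomPoints W) n := x.2
  rw [AddSubgroup.torsionBy, Submodule.mem_toAddSubgroup, Submodule.mem_torsionBy_iff] at h
  rw [AddSubgroupClass.coe_zsmul, ZeroMemClass.coe_zero]
  exact h

/-- **Step A.** If `σ ∈ Γ_K` fixes a NON-ZERO `P ∈ E[2]` then `σQ − Q ∈ ℤP` for every `Q ∈ E[2]`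
(`E` elliptic, `char K = 0`, so `#E[2] = 4`: in the basis `(P, Q)` of `E[2] ≅ 𝔽₂²`, `σ = (1 *; 0 1)`).
Proof: `E[2] = ℤP + ℤQ` for `Q ∉ ℤP` (`sup_zmultiples_eq_top_of_not_mem`), `σQ = c + kQ`, and `k` is odd
since otherwise `Q = σ⁻¹c ∈ ℤP`. [cite: SilvermanAEC2009, Cor. III.6.4 (b) (E[m] ≅ (ℤ/m)²)] -/
theorem smul_sub_mem_zmultiples_of_smul_eq [CharZero K] [W.IsElliptic] {P : geomTorsion W 2}
    (hP : P ≠ 0) {σ : absoluteGaloisGroup K} (hσ : σ • P = P) (Q : geomTorsion W 2) :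
    σ • Q - Q ∈ AddSubgroup.zmultiples P := by
  haveI : Fact (Nat.Prime 2) := ⟨Nat.prime_two⟩
  set C : AddSubgroup (geomTorsion W 2) := AddSubgroup.zmultiples P with hC
  -- the multiples of `P` are fixed by `σ` and by `σ⁻¹`
  have hfix : ∀ x ∈ C, σ • x = x := by
    intro x hx
    obtain ⟨k, rfl⟩ := AddSubgroup.mem_zmultiples_iff.mp hx
    rw [smul_zsmul_geomTorsion, hσ]
  have hfix' : ∀ x ∈ C, σ⁻¹ • x = x := fun x hx => by
    rw [inv_smul_eq_iff, hfix x hx]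
  by_cases hQ : Q ∈ C
  · rw [hfix Q hQ, sub_self]; exact C.zero_mem
  · have h2P : (2 : ℕ) • P = 0 := by
      rw [← natCast_zsmul]; exact zsmul_self_geomTorsion P
    have hcard : Nat.card C = 2 := by
      rw [hC, Nat.card_zmultiples]; exact addOrderOf_eq_prime h2P hP
    have hV : Nat.card (geomTorsion W 2) = 2 ^ 2 :=
      natCard_geomTorsion_eq_sq_of_charZero (W := W) Nat.prime_two
    have htop := sup_zmultiples_eq_top_of_not_mem hcard hV hQ
    have hσQ : σ • Q ∈ C ⊔ AddSubgroup.zmultiples Q := by rw [htop]; exact AddSubgroup.mem_top _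
    obtain ⟨c, hc, z, hz, hsum⟩ := AddSubgroup.mem_sup.mp hσQ
    obtain ⟨k, rfl⟩ := AddSubgroup.mem_zmultiples_iff.mp hz
    have h2Q : (2 : ℤ) • Q = 0 := zsmul_self_geomTorsion Q
    rcases Int.even_or_odd k with ⟨m, rfl⟩ | ⟨m, rfl⟩
    · -- `k` even: `kQ = 0`, `σQ = c ∈ ℤP`, so `Q = σ⁻¹ c ∈ ℤP` — contradiction
      exfalso
      have hkQ : (m + m) • Q = 0 := by
        rw [add_zsmul, ← smul_add, ← two_zsmul, h2Q, smul_zero]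
      rw [hkQ, add_zero] at hsum
      apply hQ
      have hQ' : Q = σ⁻¹ • c := by rw [hsum, inv_smul_smul]
      rw [hQ', hfix' c hc]
      exact hc
    · -- `k` odd: `kQ = Q`, so `σQ − Q = c ∈ ℤP`
      have hkQ : (2 * m + 1) • Q = Q := by
        rw [add_zsmul, one_zsmul, mul_comm, mul_smul, h2Q, smul_zero, zero_add]
      rw [hkQ] at hsum
      rw [← hsum, add_sub_cancel_right]
      exact hc

/-- **Step B.** If `τ ∈ Γ_K` fixes `E[2]` pointwise then `τ²` fixes `E[4]` pointwise: for `T ∈ E[4]` the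
difference `D = τT − T` is `2`-torsion (`2(τT − T) = τ(2T) − 2T = 0` as `2T ∈ E[2]`), hence fixed by `τ`, and
`τ²T = τ(T + D) = T + 2D = T` — the matrix identity `(1 + 2M)² ≡ 1 (mod 4)`. Pure group-action algebra
(no hypothesis on `K` or `E`). [folklore] -/
theorem sq_smul_eq_of_forall_twoTorsion_smul_eq {τ : absoluteGaloisGroup K}
    (h : ∀ Q : geomTorsion W 2, τ • Q = Q) (T : geomTorsion W 4) : (τ ^ 2) • T = T := by
  have hT4 : (4 : ℤ) • (T : geomPoints W) = 0 := by
    have h4 := congrArg (fun x : geomTorsion W 4 => (x : geomPoints W)) (zsmul_self_geomTorsion T)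
    simpa only [AddSubgroupClass.coe_zsmul, ZeroMemClass.coe_zero] using h4
  -- `2T ∈ E[2]`, so `τ(2T) = 2T`
  have h2Tmem : (2 : ℤ) • (T : geomPoints W) ∈ geomTorsion W 2 := by
    change (2 : ℤ) • (T : geomPoints W) ∈ AddSubgroup.torsionBy (geomPoints W) 2
    rw [AddSubgroup.torsionBy, Submodule.mem_toAddSubgroup, Submodule.mem_torsionBy_iff, smul_smul]
    exact hT4
  have h2T : τ • ((2 : ℤ) • (T : geomPoints W)) = (2 : ℤ) • (T : geomPoints W) :=
    congrArg (fun x : geomTorsion W 2 => (x : geomPoints W)) (h ⟨_, h2Tmem⟩)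
  -- `D = τT − T ∈ E[2]`, so `τD = D`
  have hDmem : τ • (T : geomPoints W) - T ∈ geomTorsion W 2 := by
    change τ • (T : geomPoints W) - T ∈ AddSubgroup.torsionBy (geomPoints W) 2
    rw [AddSubgroup.torsionBy, Submodule.mem_toAddSubgroup, Submodule.mem_torsionBy_iff, smul_sub,
      ← smul_zsmul_geomPoints, h2T, sub_self]
  have hD : τ • (τ • (T : geomPoints W) - T) = τ • (T : geomPoints W) - T :=
    congrArg (fun x : geomTorsion W 2 => (x : geomPoints W)) (h ⟨_, hDmem⟩)
  have hD2 : (2 : ℤ) • (τ • (T : geomPoints W) - T) = 0 := by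
    have := hDmem
    change τ • (T : geomPoints W) - T ∈ AddSubgroup.torsionBy (geomPoints W) 2 at this
    rwa [AddSubgroup.torsionBy, Submodule.mem_toAddSubgroup, Submodule.mem_torsionBy_iff] at this
  apply Subtype.ext
  rw [AddSubgroup.torsionBy.coe_smul, pow_two, mul_smul]
  calc τ • τ • (T : geomPoints W) = τ • ((T : geomPoints W) + (τ • (T : geomPoints W) - T)) := by
        congr 1; abel
    _ = τ • (T : geomPoints W) + (τ • (T : geomPoints W) - T) := by rw [smul_add, hD]
    _ = (T : geomPoints W) + (2 : ℤ) • (τ • (T : geomPoints W) - T) := by rw [two_zsmul]; abel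
    _ = (T : geomPoints W) := by rw [hD2, add_zero]

/-- **A Galois element fixing a non-zero `2`-torsion point has order dividing `4` on `E[4]`** (`E` elliptic,
`char K = 0`): `σP = P`, `P ∈ E[2] ∖ 0` ⟹ `σ⁴ T = T` for all `T ∈ E[4]`.  Step A puts `σ` in the unipotent
stabiliser of `P` at level `2` (`WeierstrassCurve.unipotentStabilizer`), so `σ²` fixes `E[2]`
(`pow_smul_eq_self_of_mem_unipotentStabilizer`); Step B lifts to `E[4]`.  Consequently the stabiliser of `P`
acts on `E[4]` through a `2`-GROUP (an element of order `3` of `GL₂(ℤ/4)` fixes no non-zero point of `E[2]`).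
[cite: Serre1972, §IV (subgroups of GL₂(𝔽_p); the p-subgroups)] -/
theorem pow_four_smul_eq_of_smul_eq [CharZero K] [W.IsElliptic] {P : geomTorsion W 2} (hP : P ≠ 0)
    {σ : absoluteGaloisGroup K} (hσ : σ • P = P) (T : geomTorsion W 4) : (σ ^ 4) • T = T := by
  have hmem : σ ∈ W.unipotentStabilizer P := ⟨hσ, smul_sub_mem_zmultiples_of_smul_eq hP hσ⟩
  have h2 : ∀ Q : geomTorsion W 2, (σ ^ 2) • Q = Q := fun Q =>
    W.pow_smul_eq_self_of_mem_unipotentStabilizer (m := 2) hmem Q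
  have h4 := sq_smul_eq_of_forall_twoTorsion_smul_eq h2 T
  rwa [← pow_mul] at h4

/-- Bookkeeping: an element of `Γ_K` fixing `E[4]` pointwise fixes every `P ∈ E[2]` (`E[2] ⊆ E[4]`), i.e. the
kernel of `Γ_K → Gal(K(E[4])/K)` lies in `Stab(P)`. [folklore] -/
theorem mem_stabilizer_of_forall_fourTorsion_smul_eq (P : geomTorsion W 2) {σ : absoluteGaloisGroup K}
    (hσ : ∀ T : geomTorsion W 4, σ • T = T) : σ ∈ MulAction.stabilizer (absoluteGaloisGroup K) P := by
  have hP4 : (P : geomPoints W) ∈ geomTorsion W 4 := by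
    change (P : geomPoints W) ∈ AddSubgroup.torsionBy (geomPoints W) 4
    rw [AddSubgroup.torsionBy, Submodule.mem_toAddSubgroup, Submodule.mem_torsionBy_iff,
      show (4 : ℤ) = 2 * 2 from rfl, mul_smul]
    have h2 := congrArg (fun x : geomTorsion W 2 => (x : geomPoints W)) (zsmul_self_geomTorsion P)
    simp only [AddSubgroupClass.coe_zsmul, ZeroMemClass.coe_zero] at h2
    rw [h2, smul_zero]
  have h := congrArg (fun x : geomTorsion W 4 => (x : geomPoints W)) (hσ ⟨_, hP4⟩)
  exact Subtype.ext h

end TwoGroup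

/-! ## §2 The `2`-torsion point field `K(P) = K(E[4])^{Stab(P)}`: a subfield of `K(E[4])` of `2`-power index -/

section PointField

variable {K : Type u} [Field K] [CharZero K] (W : WeierstrassCurve K) [W.IsElliptic]

/-- **The image of `Stab_{Γ_K}(P)` in `Gal(K(E[4])/K)` is a `2`-group** for every non-zero `P ∈ E[2]`
(`E` elliptic, `char K = 0`): every element `g = σ|_{K(E[4])}` has `g⁴ = (σ⁴)| = 1`, because `σ⁴` fixes `E[4]`
pointwise (`pow_four_smul_eq_of_smul_eq` + `absRestrictNormalHom_divisionField_eq_one_iff`).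
[cite: Serre1972, §IV (the p-subgroups of GL₂)] [cite: SilvermanAEC2009, VIII.§1 (K(E[m])/K Galois)] -/
theorem isPGroup_two_map_stabilizer {P : geomTorsion W 2} (hP : P ≠ 0) :
    IsPGroup 2 ((MulAction.stabilizer (absoluteGaloisGroup K) P).map
      (absRestrictNormalHom (W.divisionField 4))) := by
  intro g
  refine ⟨2, ?_⟩
  obtain ⟨σ, hσ, hσg⟩ := Subgroup.mem_map.mp g.2
  apply Subtype.ext
  rw [show (2 : ℕ) ^ 2 = 4 from rfl, SubmonoidClass.coe_pow, OneMemClass.coe_one, ← hσg, ← map_pow,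
    W.absRestrictNormalHom_divisionField_eq_one_iff 4]
  intro T
  exact pow_four_smul_eq_of_smul_eq hP (MulAction.mem_stabilizer_iff.mp hσ) T

/-- **`K(P) ⊆ K(E[4])`**: the `2`-torsion point field, rendered as the lift to `K̄` of the fixed field of the
image of `Stab_{Γ_K}(P)` in `Gal(K(E[4])/K)`, lies below the `4`-division field (Lim's hypothesis «`L` a
subfield of `F(E[4])`» at `p = 2`). [cite: Lim2017FineSelmer, §3 Thm. 3.5 (the field L)] -/
theorem lift_fixedField_map_stabilizer_le_divisionField (P : geomTorsion W 2) :
    IntermediateField.lift (IntermediateField.fixedField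
      ((MulAction.stabilizer (absoluteGaloisGroup K) P).map (absRestrictNormalHom (W.divisionField 4))))
      ≤ W.divisionField 4 :=
  IntermediateField.lift_le _

/-- **Lim's index hypothesis at `p = 2`, structurally: `[K(E[4]) : K] = 2^k · [K(P) : K]`** for every
non-zero `P ∈ E[2]` (`E` elliptic, `char K = 0`) — the relative degree `[K(E[4]) : K(P)]` is the order of the
image of `Stab(P)` in `Gal(K(E[4])/K)`, a `2`-group (`isPGroup_two_map_stabilizer`).  No count of `GL₂(ℤ/4)`
is used.  For `E[2]` irreducible, `K(P)` is the cubic field of a root of the `2`-division cubic and `k ≤ 5`.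
[cite: Lim2017FineSelmer, §3 Thm. 3.5 (hypothesis on L)] [cite: Serre1972, §IV] -/
theorem exists_finrank_divisionField_four_eq_pow_mul_finrank {P : geomTorsion W 2} (hP : P ≠ 0) :
    ∃ k : ℕ, Module.finrank K (W.divisionField 4) =
      2 ^ k * Module.finrank K (IntermediateField.lift (IntermediateField.fixedField
        ((MulAction.stabilizer (absoluteGaloisGroup K) P).map (absRestrictNormalHom (W.divisionField 4))))) := by
  haveI : Fact (Nat.Prime 2) := ⟨Nat.prime_two⟩
  set H := (MulAction.stabilizer (absoluteGaloisGroup K) P).map (absRestrictNormalHom (W.divisionField 4))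
    with hH
  obtain ⟨k, hk⟩ := IsPGroup.iff_card.mp (isPGroup_two_map_stabilizer W hP)
  refine ⟨k, ?_⟩
  have htower := Module.finrank_mul_finrank K (IntermediateField.fixedField H) (W.divisionField 4)
  rw [IntermediateField.finrank_fixedField_eq_card H, hk] at htower
  have hlift : Module.finrank K (IntermediateField.lift (IntermediateField.fixedField H)) =
      Module.finrank K (IntermediateField.fixedField H) :=
    (IntermediateField.liftAlgEquiv (IntermediateField.fixedField H)).toLinearEquiv.finrank_eq.symm
  rw [hlift, ← htower, mul_comm]

/-- **The two spellings of the `2`-torsion point field agree**: the lift to `K̄` of `K(E[4])^{Stab(P)|}` IS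
the fixed field `K̄^{Stab(P)}` of the full stabiliser of `P` in `Γ_K` — the tree's torsion-point field `ℚ(P)`
(`Rank1Residual.pointField`, `SmallImageMu.TorsionPointFieldMuSufficesOnClassX9`).  (`⊇`: an element fixed by
`Stab(P) ⊇ Gal(K̄/K(E[4]))` lies in `K(E[4])` by the Galois correspondence `InfiniteGalois.fixedField_fixingSubgroup`.)
[cite: NeukirchANT1999, Ch. IV §1 Thm. (1.2) (infinite Galois correspondence)] -/
theorem lift_fixedField_map_stabilizer_eq (P : geomTorsion W 2) :
    IntermediateField.lift (IntermediateField.fixedField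
      ((MulAction.stabilizer (absoluteGaloisGroup K) P).map (absRestrictNormalHom (W.divisionField 4))))
      = IntermediateField.fixedField (MulAction.stabilizer (absoluteGaloisGroup K) P) := by
  haveI : IsGalois K (AlgebraicClosure K) := {}
  set S := MulAction.stabilizer (absoluteGaloisGroup K) P with hS
  apply le_antisymm
  · intro x hx
    obtain ⟨y, hy, rfl⟩ := hx
    rw [IntermediateField.mem_fixedField_iff]
    intro σ hσ
    have hy' := (IntermediateField.mem_fixedField_iff _ _).mp hy
      (absRestrictNormalHom (W.divisionField 4) σ) (Subgroup.mem_map_of_mem _ hσ)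
    have h := congrArg (fun z : W.divisionField 4 => (z : AlgebraicClosure K)) hy'
    change ((AlgEquiv.restrictNormalHom (W.divisionField 4) (absoluteGaloisGroup.toAlgEquiv K σ) y :
      W.divisionField 4) : AlgebraicClosure K) = y at h
    rw [AlgEquiv.restrictNormalHom_apply] at h
    exact h
  · intro x hx
    rw [IntermediateField.mem_fixedField_iff] at hx
    have hxM : x ∈ W.divisionField 4 := by
      rw [← InfiniteGalois.fixedField_fixingSubgroup (W.divisionField 4),
        IntermediateField.mem_fixedField_iff]
      intro τ hτ
      have hτ' : (absoluteGaloisGroup.toAlgEquiv K).symm τ ∈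
          fixingSubgroupOfModule K (geomTorsion W ((4 : ℕ) : ℤ)) := by
        rw [← W.fixingSubgroup_divisionField 4]; exact hτ
      exact hx _ (mem_stabilizer_of_forall_fourTorsion_smul_eq P
        ((W.mem_fixingSubgroupOfModule_geomTorsion_iff 4).mp hτ'))
    refine ⟨⟨x, hxM⟩, ?_, rfl⟩
    change (⟨x, hxM⟩ : W.divisionField 4) ∈
      IntermediateField.fixedField (S.map (absRestrictNormalHom (W.divisionField 4)))
    rw [IntermediateField.mem_fixedField_iff]
    rintro g hg
    obtain ⟨σ, hσ, rfl⟩ := Subgroup.mem_map.mp hg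
    apply Subtype.ext
    change ((AlgEquiv.restrictNormalHom (W.divisionField 4) (absoluteGaloisGroup.toAlgEquiv K σ) ⟨x, hxM⟩ :
      W.divisionField 4) : AlgebraicClosure K) = x
    rw [AlgEquiv.restrictNormalHom_apply]
    exact hx σ hσ

/-- **`K(P) ⊆ K(E[4])`** for the torsion-point field `K(P) = K̄^{Stab(P)}` of any `P ∈ E[2]` (the tree's
spelling `IntermediateField.fixedField (MulAction.stabilizer Γ_K P)`, cf. `Rank1Residual.pointField`) — the
first conjunct of Lim's hypothesis at `p = 2`. [cite: Lim2017FineSelmer, §3 Thm. 3.5 (the field L ⊆ F(E[4]))] -/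
theorem fixedField_stabilizer_le_divisionField_four (P : geomTorsion W 2) :
    IntermediateField.fixedField (MulAction.stabilizer (absoluteGaloisGroup K) P) ≤ W.divisionField 4 := by
  rw [← lift_fixedField_map_stabilizer_eq W P]
  exact lift_fixedField_map_stabilizer_le_divisionField W P

/-- **`[K(E[4]) : K] = 2^k · [K(P) : K]` for the torsion-point field `K(P) = K̄^{Stab(P)}` of a NON-ZERO
`P ∈ E[2]`** (`E` elliptic, `char K = 0`) — the second conjunct of Lim's hypothesis at `p = 2`, in the spelling
of the tree's named fact `Lim2017.thm35_at_two_fineSelmerDual_moduleFinite_of_classicalMuVanishes_of_le_divisionField_four`.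
STRUCTURAL: the relative degree is the order of the `2`-group `Stab(P)|_{K(E[4])}`; no count of `GL₂(ℤ/4)`.
[cite: Lim2017FineSelmer, §3 Thm. 3.5 (hypothesis on L)] [cite: Serre1972, §IV] -/
theorem exists_finrank_divisionField_four_eq_pow_mul_finrank_fixedField_stabilizer {P : geomTorsion W 2}
    (hP : P ≠ 0) :
    ∃ k : ℕ, Module.finrank K (W.divisionField 4) =
      2 ^ k * Module.finrank K (IntermediateField.fixedField (MulAction.stabilizer (absoluteGaloisGroup K) P)) := by
  rw [← lift_fixedField_map_stabilizer_eq W P]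
  exact exists_finrank_divisionField_four_eq_pow_mul_finrank W hP

/-- `K(P)/K` is finite for every `P ∈ E[2]` (a subfield of the finite extension `K(E[4])`). [folklore] -/
theorem finiteDimensional_fixedField_stabilizer (P : geomTorsion W 2) :
    FiniteDimensional K (IntermediateField.fixedField (MulAction.stabilizer (absoluteGaloisGroup K) P)) :=
  FiniteDimensional.of_injective
    (IntermediateField.inclusion (fixedField_stabilizer_le_divisionField_four W P)).toLinearMap
    (IntermediateField.inclusion_injective (fixedField_stabilizer_le_divisionField_four W P))

/-- **Every elliptic curve has a non-zero geometric `2`-torsion point** (`#E[2] = 4` in characteristic `0`).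
[cite: SilvermanAEC2009, Cor. III.6.4 (b)] -/
theorem exists_twoTorsion_ne_zero : ∃ P : geomTorsion W 2, P ≠ 0 := by
  by_contra h
  push Not at h
  have hsub : Subsingleton (geomTorsion W 2) := ⟨fun a b => by rw [h a, h b]⟩
  have hcard : Nat.card (geomTorsion W 2) = 2 ^ 2 :=
    natCard_geomTorsion_eq_sq_of_charZero (W := W) Nat.prime_two
  haveI : Finite (geomTorsion W 2) := Nat.finite_of_card_ne_zero (by rw [hcard]; norm_num)
  have h1 : Nat.card (geomTorsion W 2) ≤ 1 := Finite.card_le_one_iff_subsingleton.mpr hsub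
  rw [hcard] at h1
  norm_num at h1

end PointField

end Summit.BirchSwinnertonDyer.BirchSwinnertonDyer.Theorems.AlignedTransportAtTwoTorsionPointField

end
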